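import Summits.BirchSwinnertonDyer.Rank1Residual.Additive.KatoDescentRankOneCountContraCut
import Summits.BirchSwinnertonDyer.Rank1Residual.Additive.KatoDescentTorsionFreeReadings
import Summits.BirchSwinnertonDyer.Rank1Residual.Additive.UnramifiedBaseChange
import Summits.BirchSwinnertonDyer.BirchSwinnertonDyer.Theorems.CongruentShaFreeCutKatoKummerLogTorsion
import Literature.NumberTheory.EllipticCurves.Kato2004.AdmissibleZetaClassBottomLayerProofs
import Literature.NumberTheory.EllipticCurves.Kato2004.PerrinRiouRatio
import Literature.NumberTheory.EllipticCurves.Kato2004.IwasawaH2DescentRankOne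
import Literature.NumberTheory.EllipticCurves.BSDRootNumberLocalTablesProofs
import Literature.NumberTheory.EllipticCurves.RootNumberProofs
import Literature.NumberTheory.EllipticCurves.LeadingTerm
import Mathlib.LinearAlgebra.Dimension.Torsion.Finite
import HarnessLib

set_option autoImplicit false

/-!
# Stub 3 `stub_rankOneCountReadingKato` of the Kato–Perrin-Riou skeletons v4 REDUCED to named and displayed
# inputs: `TorsionFree.RankOneCountReading IsKatoZetaDescentDatumOfContra Kato2004.PRRatio` (verbatim the stub's
# type; cruxes stmt-BirchSwinnertonDyer-19945 `…/Lines/kato_perrin_riou_zp.lean`, stmt-BirchSwinnertonDyer-19223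
# `…/Lines/kato_perrin_riou_istar.lean`; cell bsd-potss's held input 27322) from Gross–Zagier–Kolyvagin,
# `Kato2004.finite_descentCokernel_of_rankOne`, `IsNewformOf.level_eq_conductorNorm` and four DISPLAYED print
# schemata — seat `bsd-cm-prr-ty1` g7, cell `bsd-cm` (planner D423); theorems only: no definition, no named fact,
# no instance, no `sorry`

Part 2 of the seat's kernel cut of stub 3 (part 1 = `KatoDescentRankOneCountContraCut.lean`: conjunct (i); step K1 =
`Literature/…/Kato2004/AdmissibleZetaClassBottomLayerProofs.lean`: the (A6′) position clause at the bottom layer).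

* §1 kernel plumbing: Kato's index and `#𝐇²_Γ/T` along the pin of the closed `IsOf`; a generator of `W(ℚ)/tors` on a
  rank-one curve has `log_ω ≠ 0` in `W(ℚ_p)`; at an ADDITIVE `p`, `p² ∣ N_W` and `a_p = 0`, so `P_p(p⁻¹) = 1` and
  `∏_{ℓ∣pA} P_ℓ(ℓ⁻¹) = ∏_{ℓ∣A,ℓ≠p} P_ℓ(ℓ⁻¹)` — the `pA`-depleted normalisation of `Kato2004.PRRatio` and the
  `prime(A)∖{p}` multiplier of `IsAdmissibleZetaClass` AGREE on the reading's rows; `p`-adic valuation helpers.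
* §2 the displayed schemata (docstring there) and §3 the reduction `rankOneCountReading_contra_of_facts`, whose
  conclusion is LITERALLY the stub's type. RESIDUAL OF STUB 3 after this file = {GZK (held print input),
  `Kato2004.finite_descentCokernel_of_rankOne` (named fact, cell bsd-cn100), `IsNewformOf.level_eq_conductorNorm` (named
  fact), LOG-EX, LOG-HOM, PR-INV, COUNT (displayed, not minted)}; a prover closes the stub by
  `exact ContraCount.rankOneCountReading_contra_of_facts h₁ … h₇` the day terms of those seven types exist.

HONEST LABEL: conditional reductions on displayed hypotheses; no stub or item is closed; nothing is registered;
nothing is asserted on 19945 / 19223; Kato's Main Conjecture and Perrin-Riou's conjecture are not touched; BSD is not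
proved for any curve. `Summits/…/Theorems/` being prover-only (D-0016), the file lives next to the binders it serves.

References: [Kato2004Asterisque] §13.9–13.12 (pp. 229–231), (14.9.3) (p. 240), §14.14 (p. 243), Prop. 14.16 (p. 244);
[BurnsKuriharaSano2019] Thm. 7.3 / 7.8 (d); [BlochKato1990] 3.10–3.11; [CoatesLNM1716] L. 3.6/3.8; [GreenbergLNM1716] §3;
[Kim2022StructureSelmer] §3.2.3; [Darmon2004] Thm. 3.22; [Silverman1994] IV.10.2; [SilvermanAEC2009] IV.6.4, VII.5.1, C.16.
-/

noncomputable section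

open scoped Classical NumberField BigOperators

open WeierstrassCurve Field IsDedekindDomain Rat.HeightOneSpectrum Literature.NumberTheory.EllipticCurves
  Literature.NumberTheory.EllipticCurves.ModularForms
  Literature.NumberTheory.EllipticCurves.Rank1Residual Literature.NumberTheory.EllipticCurves.Rank1Residual.Typed
  Literature.NumberTheory.EllipticCurves.Kato2004 Literature.NumberTheory.EllipticCurves.IwasawaAlgebra
  Literature.NumberTheory.EllipticCurves.Kato2004.EulerSystemValues
  Literature.NumberTheory.GaloisRepresentations
open Summit.BirchSwinnertonDyer.BirchSwinnertonDyer.Theorems.CongruentShaFreeCutKatoDescentDatumOfH2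
  Summit.BirchSwinnertonDyer.BirchSwinnertonDyer.Theorems.CongruentShaFreeCutKatoKummerLogTorsion

namespace Summit.BirchSwinnertonDyer.Rank1Residual.Additive.ContraCount

/-! ## §1 Kernel plumbing: the index along the pin, the generator, the Euler factor at the additive prime -/

section Pin

variable {W : WeierstrassCurve ℚ} [W.IsElliptic] {p : ℕ} [Fact p.Prime]
  [ContinuousSMul ℤ_[p] (W.tateModule p)] {D : KatoDescentDatum p} (P : KatoDescentDatumPinH2 W p D)

/-- **Kato's index along the pin**: `[D.A : Λ·D.ι[D.z]] = [J.A : Λ·J.ι[eH D.z]]` (`eA` carries `D.ι[x]` to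
`J.ι[eH x]`, `eA_ι`). [cite: Kato2004Asterisque, Thm. 14.5 and the definition of `[M : z]` (pp. 236–237), §14.14 (14.14.1) (p. 243)] -/
theorem zetaIndex_eq_natCard_pin :
    D.zetaIndex = Nat.card (P.J.A ⧸ (IwasawaAlgebra p) ∙ P.J.ι (Submodule.Quotient.mk (P.eH D.z))) := by
  have hmap : ((IwasawaAlgebra p) ∙ D.ι (Submodule.Quotient.mk D.z)).map
      (P.eA : D.A →ₗ[IwasawaAlgebra p] P.J.A) =
      (IwasawaAlgebra p) ∙ P.J.ι (Submodule.Quotient.mk (P.eH D.z)) := by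
    rw [Submodule.map_span, Set.image_singleton, LinearEquiv.coe_coe, P.eA_ι]
  exact Nat.card_congr (Submodule.Quotient.equiv _ _ P.eA hmap).toEquiv

/-- **`#(D.H2)_Γ` along the pin**: `#(D.H2/T) = #(J.H2/T)` (`eH2`). [cite: Kato2004Asterisque, §14.14 (14.14.2) (p. 243)] -/
theorem h2Card_eq_natCard_pin : D.h2Card = Nat.card (coinvariants p P.J.H2) :=
  Nat.card_congr (coinvariantsEquiv P.eH2).toEquiv

end Pin

section Generator

variable {W : WeierstrassCurve ℚ} [W.IsElliptic]

omit [W.IsElliptic] in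
/-- A point generating `W(ℚ)` modulo torsion on a rank-ONE curve has infinite order (otherwise every point is
torsion and `rank_ℤ W(ℚ) = 0`). [cite: SilvermanAEC2009, VIII.6.7 (Mordell–Weil: rank)] -/
theorem not_isOfFinAddOrder_of_generates (hrank : W.mordellWeilRank = 1) {P : W.toAffine.Point}
    (hP : ∀ Q : W.toAffine.Point, ∃ n : ℤ, IsOfFinAddOrder (Q - n • P)) : ¬ IsOfFinAddOrder P := by
  intro hPt
  have htors : Module.IsTorsion ℤ W.toAffine.Point := by
    intro Q
    obtain ⟨n, hn⟩ := hP Q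
    have hQ : IsOfFinAddOrder Q := by
      have h := hn.add (hPt.zsmul (i := n))
      rwa [sub_add_cancel] at h
    obtain ⟨k, hk, hkQ⟩ := hQ.exists_nsmul_eq_zero
    refine ⟨⟨(k : ℤ), mem_nonZeroDivisors_of_ne_zero (by exact_mod_cast hk.ne')⟩, ?_⟩
    change (k : ℤ) • Q = 0
    rw [natCast_zsmul, hkQ]
  have h0 : Module.rank ℤ W.toAffine.Point = 0 := rank_eq_zero_iff_isTorsion.mpr htors
  have h1 := Module.finrank_eq_zero_of_rank_eq_zero h0
  -- `mordellWeilRank` is elaborated against the classical `DecidableEq ℚ` (generic `K` in `MordellWeil.lean`);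
  -- `convert` bridges the (subsingleton) decidability instances
  have : W.mordellWeilRank = 0 := by
    unfold WeierstrassCurve.mordellWeilRank
    convert h1
  omega

/-- Hence its image in `W(ℚ_p)` has `log_ω ≠ 0` (the logarithm kills exactly the torsion:
`isOfFinAddOrder_of_padicLogLocal_eq_zero`; `E(ℚ) → E(ℚ_p)` is an injective homomorphism).
[cite: SilvermanAEC2009, IV.6.4 and VII.6.3] -/
theorem padicLogLocal_map_ne_zero_of_generates [W.IsGloballyMinimal] (p : ℕ) [Fact p.Prime]
    (hrank : W.mordellWeilRank = 1) {P : W.toAffine.Point}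
    (hP : ∀ Q : W.toAffine.Point, ∃ n : ℤ, IsOfFinAddOrder (Q - n • P)) :
    padicLogLocal W p
      (WeierstrassCurve.Affine.Point.map (W' := W.toAffine) (S := ℚ) (Algebra.ofId ℚ ℚ_[p]) P) ≠ 0 := by
  intro h0
  have hfin := isOfFinAddOrder_of_padicLogLocal_eq_zero W p h0
  refine not_isOfFinAddOrder_of_generates hrank hP ?_
  rw [← addOrderOf_pos_iff] at hfin ⊢
  rwa [addOrderOf_injective _ (WeierstrassCurve.Affine.Point.map_injective (W' := W.toAffine)
    (f := Algebra.ofId ℚ ℚ_[p])) P] at hfin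

end Generator

section Euler

variable (W : WeierstrassCurve ℚ) [W.IsElliptic] (p : ℕ) [hp : Fact p.Prime]

/-- **`p² ∣ N_W` at an additive `p`** (`Addv W p` ⇒ additive reduction at the place of `ℤ` over `p` by the local
trichotomy and the prime/place bridges of the tree; `f_v ≥ 2` there, `natGenerator_sq_dvd_conductorNorm_iff`).
[cite: Silverman1994, IV.10.2(c)] [cite: SilvermanAEC2009, VII.5 Prop. 5.1] -/
theorem sq_dvd_conductorNorm_of_addv (hadd : Addv W p) : p ^ 2 ∣ W.conductorNorm ℤ := by
  set vZ : HeightOneSpectrum ℤ := (primesEquiv (R := ℤ)).symm ⟨p, hp.out⟩ with hvZ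
  have hgen : natGenerator vZ = p := by
    change ((primesEquiv vZ : Nat.Primes) : ℕ) = p
    rw [hvZ, Equiv.apply_symm_apply]
  have hng : ¬ W.HasGoodReductionAt vZ := fun h ↦
    hadd.1 ((W.hasGoodReductionAtPrime_iff_hasGoodReductionAt_holds ⟨p, hp.out⟩).mpr h)
  have hnm : ¬ W.HasMultiplicativeReductionAt vZ := fun h ↦
    hadd.2 ((hasMultiplicativeReductionAtPrime_iff_hasMultiplicativeReductionAt_holds W ⟨p, hp.out⟩).mpr h)
  have haddZ : W.HasAdditiveReductionAt vZ := by
    rcases W.hasGoodReductionAt_or_hasMultiplicativeReductionAt_or_hasAdditiveReductionAt vZ with h | h | h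
    · exact absurd h hng
    · exact absurd h hnm
    · exact h
  simpa only [hgen] using (natGenerator_sq_dvd_conductorNorm_iff vZ W).mpr haddZ

/-- **`a_p(W) = 0` at an additive `p`.** [cite: SilvermanAEC2009, §C.16 (definition of L_v(T))] -/
theorem lFunction_eq_zero_of_addv (hadd : Addv W p) : W.LFunction p = 0 :=
  W.LFunction_apply_eq_zero_of_hasAdditiveReductionAt (v := (primesEquiv (R := 𝓞 ℚ)).symm ⟨p, hp.out⟩)
    (by simp) (hasAdditiveReductionAt_of_addv W p hadd) (dvd_refl p)

/-- **The Euler factor at the additive prime is `1`**: `P_p(p⁻¹) = 1 − a_p/p + ε(p)/p = 1` since `a_p = 0` and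
`p ∣ N` (for `f` of level `N = N_W`, the named fact `IsNewformOf.level_eq_conductorNorm` supplying `N = N_W`).
[cite: Kato2004Asterisque, Ex. 13.3 (p. 225)] [cite: Silverman1994, IV.10.2(c)] -/
theorem eulerFactorAtOne_eq_one_of_addv (hadd : Addv W p) {N : ℕ} (hN : N = W.conductorNorm ℤ) :
    eulerFactorAtOne W N p = 1 := by
  have hpN : p ∣ N := by
    rw [hN]
    exact (dvd_pow_self p two_ne_zero).trans (sq_dvd_conductorNorm_of_addv W p hadd)
  unfold eulerFactorAtOne
  rw [lFunction_eq_zero_of_addv W p hadd, if_pos hpN]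
  simp

omit hp in
/-- `∏_{ℓ ∣ pA} P_ℓ = P_p · ∏_{ℓ ∣ A, ℓ ≠ p} P_ℓ` (`A ≥ 1`, `p` prime). [folklore] -/
private theorem prod_primeFactors_mul_eq (hp' : p.Prime) {A : ℕ} (hA : 0 < A) (P : ℕ → ℚ) :
    ∏ ℓ ∈ (p * A).primeFactors, P ℓ = P p * ∏ ℓ ∈ A.primeFactors.erase p, P ℓ := by
  have hpa : (p * A).primeFactors = insert p A.primeFactors := by
    rw [Nat.primeFactors_mul hp'.ne_zero hA.ne', hp'.primeFactors]
    rfl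
  rw [hpa, ← Finset.mul_prod_erase _ _ (Finset.mem_insert_self p _), Finset.erase_insert_eq_erase]

/-- **At an additive `p`: `∏_{ℓ ∣ pA} P_ℓ(ℓ⁻¹) = ∏_{ℓ ∣ A, ℓ ≠ p} P_ℓ(ℓ⁻¹)`** — the `pA`-depletion of
`Kato2004.PRRatio`'s normalisation and the `A ∖ {p}`-product of `IsAdmissibleZetaClass`'s multiplier AGREE on the
reading's rows. [cite: Kato2004Asterisque, Ex. 13.3 (p. 225), §13.9 (p. 229)] -/
theorem prod_eulerFactorAtOne_primeFactors_mul_eq_of_addv (hadd : Addv W p) {N : ℕ}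
    (hN : N = W.conductorNorm ℤ) {A : ℕ} (hA : 0 < A) :
    ∏ ℓ ∈ (p * A).primeFactors, eulerFactorAtOne W N ℓ = ∏ ℓ ∈ A.primeFactors.erase p, eulerFactorAtOne W N ℓ := by
  rw [prod_primeFactors_mul_eq p hp.out hA, eulerFactorAtOne_eq_one_of_addv W p hadd hN, one_mul]

end Euler

section Valuation

variable {p : ℕ} [Fact p.Prime]

/-- A `p`-adic number of norm `1` has valuation `0`. [folklore] -/
private theorem valuation_eq_zero_of_norm_eq_one {w : ℚ_[p]} (hw : ‖w‖ = 1) : w.valuation = 0 := by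
  have hw0 : w ≠ 0 := fun h => by rw [h, norm_zero] at hw; exact zero_ne_one hw
  rw [Padic.norm_eq_zpow_neg_valuation hw0] at hw
  have hp : (1 : ℝ) < p := by exact_mod_cast (Fact.out : p.Prime).one_lt
  have := (zpow_right_injective₀ (zero_lt_one.trans hp) hp.ne') (hw.trans (zpow_zero _).symm)
  simpa using this

/-- `v(a·b/c/d²) = v a + v b − v c − 2·v d` for non-zero `p`-adic numbers. [folklore] -/
private theorem valuation_mul_div_div_sq {a b c d : ℚ_[p]} (ha : a ≠ 0) (hb : b ≠ 0) (hc : c ≠ 0) (hd : d ≠ 0) :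
    (a * b / c / d ^ 2).valuation = a.valuation + b.valuation - c.valuation - 2 * d.valuation := by
  rw [div_eq_mul_inv, div_eq_mul_inv, Padic.valuation_mul (mul_ne_zero (mul_ne_zero ha hb) (inv_ne_zero hc))
      (inv_ne_zero (pow_ne_zero 2 hd)), Padic.valuation_mul (mul_ne_zero ha hb) (inv_ne_zero hc),
    Padic.valuation_mul ha hb, Padic.valuation_inv, Padic.valuation_inv, Padic.valuation_pow]
  ring

end Valuation

/-! ## §2 The reduction: stub 3 from three named inputs and four displayed print schemata

The DISPLAYED schemata (hypotheses `hLogEx`, `hLogHom`, `hPRinv`, `hCount` below; none is a tree theorem, none is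
minted as a named fact here — D423 of cell bsd-cm):

* LOG-EX — **every bottom class of `𝐇¹_Γ(T_pW)` has a Kummer logarithm in analytic rank one**: for `κ`
  cyclotomic, `I : IwasawaH1Data W p κ γ`, `x ∈ I.H`, `r_an(W) = 1`: `∃ t, HasLocPKummerLog (proj₀ x) t`. PRINT:
  `proj₀ x ∈ H¹(ℤ[1/p], T_pW)` (Kato §8.2/(14.14.1)) and `H¹(ℤ[1/p], V) = H¹_f(ℚ, V) = E(ℚ) ⊗ ℚ_p` when
  `r_an = 1` (Kato (14.9.3) with local duality: the singular quotient `H¹_s(ℚ_p, V)` is dual to `loc_p` on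
  `H¹_f(ℚ, V)`, which is injective in rank one; Gross–Zagier–Kolyvagin for `rank = 1`, `Ш[p^∞]` finite); the
  Kummer image is `H¹_f(ℚ_p, V)` (Bloch–Kato Ex. 3.11).
  [Kato2004Asterisque (14.9.3) p. 240, §14.14 p. 243; BlochKato1990 Ex. 3.11; BurnsKuriharaSano2019 (h1) p. 9]
* LOG-HOM — **the Kummer logarithm is single-valued and `ℤ_p`-linear**: `c₁ • x = c₂ • y`, `HasLocPKummerLog x s`,
  `HasLocPKummerLog y t` ⇒ `c₁·s = c₂·t` (Bloch–Kato's `log` on `H¹_f(ℚ_p, V)` is a homomorphism). [BlochKato1990 3.10–3.11]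
* PR-INV — **two witnesses of `Kato2004.PRRatio W p` differ by a `p`-adic unit**: Kato's zeta element is
  independent of the auxiliary choices `(c, d, α, j)` (§13.9, p. 230 lines 4–6, via Thm. 12.4 (2) and (13.7.1)), the
  Euler-factor bookkeeping of §13.12, and the Néron normalisation (Z2) of the dual-exponential coordinate pin the
  ratio `ℒ` of `PRRatioBody` up to `ℤ_pˣ` (SPEC-PRRATIO §2 of cell bsd-cm: "`v_p ℒ` is an invariant of `(W, p)`").
  [Kato2004Asterisque §13.9 p. 230, Lemma 13.10 p. 230, §13.12 p. 231, Thm. 12.4 (2) p. 221; BlochKato1990 Prop. 3.8]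
* COUNT — **the rank-one Poitou–Tate count for Kato's (`H¹(ℤ[1/p], T_pW)`, `𝐇²_Γ(T_pW)`) read through the
  Kummer logarithm, for ANY `x ∈ 𝐇¹_Γ`** (zeta-free): on the reading's rows, for a descent package `J` whose `H2`
  carries the (H2ᶜ) lengths (those of `X₀(ℚ_∞)` in the contragredient key — WITHOUT this pin the abstract `J.H2` of
  `IwasawaH2Data` is cookable, `#(J.H2)_Γ` being free: the D360/D362 audit of cell bsd-cm; with it and (14.14.1)
  `#(J.H2)_Γ` is Kato's `#H²(ℤ[1/p], T_pW)` by the `T`-Euler-characteristic formula), with `P` a generator of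
  `W(ℚ)/tors` and `s` a Kummer log of `proj₀ x`: `s ≠ 0 ↔ [A : proj₀ x] ≠ 0`, and `[A : proj₀ x] = p^m·#𝐇²_Γ/T ⇒
  v_p s = m + ord_p #Ш[p^∞] + ord_p Tam + 2·v_p log_ω(P)` — the content of cell bsd-potss's memo R1-a…R1-f
  (Kato (14.9.3) + Poitou–Tate for Kummer ⊂ unramified at `ℓ ≠ p` + Coates' exact annihilators + Greenberg §3 +
  Kim's additive local index), i.e. the reading `TorsionFree.RankOneCountReading` with the zeta element REMOVED.
  [Kato2004Asterisque (14.9.3) p. 240, §14.14 p. 243, Prop. 14.16 p. 244; CoatesLNM1716 Lemma 3.6/3.8;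
  GreenbergLNM1716 §3; Kim2022StructureSelmer §3.2.3; BurnsKuriharaSano2019 Thm. 7.3 / 7.8 (d)]

NAMED inputs: `rank_eq_analyticRank_of_analyticRank_le_one` (GZK), `Kato2004.finite_descentCokernel_of_rankOne` (cn100),
`IsNewformOf.level_eq_conductorNorm` (level of the newform = conductor; used only for `P_p(p⁻¹) = 1` at the additive `p`).
-/

section Reduction

/-- **STUB 3 REDUCED.** `TorsionFree.RankOneCountReading IsKatoZetaDescentDatumOfContra Kato2004.PRRatio` (verbatim
the type of `stub_rankOneCountReadingKato` of both Kato–Perrin-Riou skeletons v4) follows from Gross–Zagier–Kolyvagin,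
cn100's `Kato2004.finite_descentCokernel_of_rankOne`, `IsNewformOf.level_eq_conductorNorm`, and the displayed schemata
LOG-EX, LOG-HOM, PR-INV, COUNT (§2). Proof: (i) is part 1; the closed `IsOf` pins `D` to (`P.I`, `P.J`) with an
ADMISSIBLE `z₀ = P.eH D.z` whose body contains a value-pinned Kato family with lift `y′` — verbatim the clauses
(Z0)–(Z5) of `PRRatioBody` — so with a Kummer log `t′` of `proj₀ y′` (LOG-EX) and the generator `P` of the given
witness, `ℒ′ := t′·λ′/(q′·R′·∏_{ℓ∣pA′}P_ℓ)/log_ω(P)²` is a SECOND witness of `Kato2004.PRRatio W p`; PR-INV: `ℒ = w·ℒ′`,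
`‖w‖ = 1`; K1 (`Kato2004.IwasawaH1Data.exists_proj_zero_smul_eq_of_position`): `c₁ • proj₀ z₀ = c₂ • proj₀ y′` with
`v_p c₂ − v_p c₁ = v_p λ′ − v_p(q′R′∏_{ℓ∣A′,ℓ≠p}P_ℓ)`; LOG-HOM: `c₁·s = c₂·t′` for a Kummer log `s` of `proj₀ z₀`; COUNT
at `x = z₀` gives (ii)/(iii) in `s`-currency; indices move along the pin (§1); `∏_{ℓ∣pA′}P_ℓ = ∏_{ℓ∣A′,ℓ≠p}P_ℓ` at
the additive `p` (§1). Conditional; nothing asserted.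
[cite: Kato2004Asterisque, (14.9.3) (p. 240), §13.9 (p. 230), §14.14 (14.14.1) (p. 243), Prop. 14.16 (p. 244)]
[cite: BurnsKuriharaSano2019, Thm. 7.3 (p. 29) and Thm. 7.8 (d) (p. 30)] [cite: BlochKato1990, Def. 3.10 and Ex. 3.11]
[cite: Darmon2004, Thm. 3.22] -/
theorem rankOneCountReading_contra_of_facts
    (hGZK : rank_eq_analyticRank_of_analyticRank_le_one)
    (hfd : Kato2004.finite_descentCokernel_of_rankOne)
    (hlev : ∀ (N : ℕ) [NeZero N], IsNewformOf.level_eq_conductorNorm (N := N))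
    (hLogEx : ∀ (W : WeierstrassCurve ℚ) [W.IsElliptic] [W.IsGloballyMinimal] (p : ℕ) [Fact p.Prime],
      letI : ContinuousSMul ℤ_[p] (W.tateModule p) := TateModule.continuousSMul_padicInt
      ∀ (κ : ZpExtension ℚ p) (γ : absoluteGaloisGroup ℚ), κ.IsCyclotomic → κ.IsTopGenerator γ →
        W.analyticRank = 1 → ∀ (I : IwasawaH1Data W p κ γ) (x : I.H),
          ∃ t : ℚ_[p], HasLocPKummerLog W p (layerZeroToTop W p κ (I.proj 0 x)) t)
    (hLogHom : ∀ (W : WeierstrassCurve ℚ) [W.IsElliptic] [W.IsGloballyMinimal] (p : ℕ) [Fact p.Prime],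
      letI : ContinuousSMul ℤ_[p] (W.tateModule p) := TateModule.continuousSMul_padicInt
      ∀ (x y : H1 (tateRep W p) ⊤) (c₁ c₂ : ℤ_[p]) (s t : ℚ_[p]),
        c₁ • x = c₂ • y → HasLocPKummerLog W p x s → HasLocPKummerLog W p y t →
          (c₁ : ℚ_[p]) * s = (c₂ : ℚ_[p]) * t)
    (hPRinv : ∀ (W : WeierstrassCurve ℚ) [W.IsElliptic] [W.IsGloballyMinimal] (p : ℕ) [Fact p.Prime]
      (ℒ₁ ℒ₂ : ℚ_[p]), Kato2004.PRRatio W p ℒ₁ → Kato2004.PRRatio W p ℒ₂ → ∃ w : ℚ_[p], ‖w‖ = 1 ∧ ℒ₂ = w * ℒ₁)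
    (hCount : ∀ (W : WeierstrassCurve ℚ) [W.IsElliptic] [W.IsGloballyMinimal] (p : ℕ) [Fact p.Prime],
      letI : ContinuousSMul ℤ_[p] (W.tateModule p) := TateModule.continuousSMul_padicInt
      ∀ (κ : ZpExtension ℚ p) (γ : absoluteGaloisGroup ℚ), κ.IsCyclotomic → κ.IsTopGenerator γ →
        ∀ (I : IwasawaH1Data W p κ γ) (J : IwasawaH2Data W p κ γ I) (x : I.H) (s : ℚ_[p])
          (P : W.toAffine.Point),
          W.analyticRank = 1 → p ≠ 2 → Addv W p → 0 ≤ padicValRat p W.j → ¬ p ∣ W.torsionOrder →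
          Finite W.sha →
          (∀ (Y : W.FineSelmerDualData κ γ⁻¹) (𝔮 : PrimeSpectrum (IwasawaAlgebra p)), 𝔮.asIdeal.height = 1 →
            Module.lengthAt (IwasawaAlgebra p) J.H2 𝔮 = Module.lengthAt (IwasawaAlgebra p) Y.X 𝔮) →
          (∀ Q : W.toAffine.Point, ∃ n : ℤ, IsOfFinAddOrder (Q - n • P)) →
          HasLocPKummerLog W p (layerZeroToTop W p κ (I.proj 0 x)) s →
          (s ≠ 0 ↔ Nat.card (J.A ⧸ (IwasawaAlgebra p) ∙ J.ι (Submodule.Quotient.mk x)) ≠ 0) ∧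
            ∀ m : ℕ, Nat.card (J.A ⧸ (IwasawaAlgebra p) ∙ J.ι (Submodule.Quotient.mk x)) =
                p ^ m * Nat.card (coinvariants p J.H2) →
              s.valuation = (m : ℤ) + padicValNat p (Nat.card (AddCommGroup.primaryComponent W.sha p)) +
                padicValNat p W.tamagawaProduct +
                2 * (padicLogLocal W p
                  (WeierstrassCurve.Affine.Point.map (W' := W.toAffine) (S := ℚ) (Algebra.ofId ℚ ℚ_[p]) P)).valuation) :
    TorsionFree.RankOneCountReading IsKatoZetaDescentDatumOfContra Kato2004.PRRatio := by
  intro W _ _ p _ D ℒ hr hp2 hadd hj htors hsha hD hℒ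
  letI instC : ContinuousSMul ℤ_[p] (W.tateModule p) := TateModule.continuousSMul_padicInt
  letI instF : Module.Free ℤ_[p] (W.tateModule p) := W.module_free_tateModule_holds p
  letI instFi : Module.Finite ℤ_[p] (W.tateModule p) := W.module_finite_tateModule_holds p
  -- conjunct (i): part 1 of the cut
  have hfinH2 : Finite (coinvariants p D.H2) :=
    rankOneCountReading_finite_of_gzk_of_finite_descentCokernel hGZK hfd W p D hr hsha hD
  -- the Mordell–Weil rank (Gross–Zagier–Kolyvagin)
  obtain ⟨hmw, -⟩ := hGZK W (by rw [hr])
  have hrank : W.mordellWeilRank = 1 := by rw [hmw, hr]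
  -- the pin, the admissible class and its body
  obtain ⟨Pn, hadm, hH2⟩ := hD
  obtain ⟨hp', N', hN', f', hf', ι', q', Λ', hq', hZ', c', d₁', a', A', d'', hA', hc', hd', hdd', hR', z', x',
    hzeta', y', hy', qm, perRatio', e, u, n₁, n₂, n₃, n₄, σc, σd, σℓ, hqm, -, h₁, h₂, h₃, h₄, -, -, -, hper0',
    hper', he, hpos⟩ :=
    (Kato2004.isAdmissibleZetaClass_iff W p Pn.κ Pn.isCyclotomic Pn.I (Pn.eH D.z)).mp hadm
  haveI : NeZero N' := hN'
  -- K1: the position clause at the bottom layer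
  obtain ⟨c₁, c₂, hc₁, hc₂, hkey, hval⟩ := Pn.I.exists_proj_zero_smul_eq_of_position hf' c' d₁' a' A' d'' hq'
    hqm.ne' hper0' h₁ h₂ h₃ h₄ hR' σc σd σℓ he u hpos
  -- the generator `P` of the given witness (all its other data are discarded)
  obtain ⟨-, N, hN, f, -, -, -, -, -, -, c, d₁, a, A, d', -, -, -, -, -, -, -, -, K, hK, γK, -, IK, y, -, t, P,
    perRatio, -, hP, -, -⟩ := (Kato2004.prRatio_iff W p ℒ).mp hℒ
  have hlogP := padicLogLocal_map_ne_zero_of_generates p hrank hP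
  -- Kummer logarithms on the admissible side (LOG-EX)
  obtain ⟨t', ht'⟩ := hLogEx W p Pn.κ Pn.γ Pn.isCyclotomic Pn.isTopGenerator hr Pn.I y'
  obtain ⟨s, hs⟩ := hLogEx W p Pn.κ Pn.γ Pn.isCyclotomic Pn.isTopGenerator hr Pn.I (Pn.eH D.z)
  -- the admissible family is a second PRRatio witness
  set G : ℚ_[p] := padicLogLocal W p
    (WeierstrassCurve.Affine.Point.map (W' := W.toAffine) (S := ℚ) (Algebra.ofId ℚ ℚ_[p]) P) with hG
  set M : ℚ := q' * ratCuspFactor f' true c' d₁' a' A' d'' *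
    ∏ ℓ ∈ (p * A').primeFactors, eulerFactorAtOne W N' ℓ with hM
  set ℒ' : ℚ_[p] := t' * ((perRatio' : ℚ) : ℚ_[p]) / ((M : ℚ) : ℚ_[p]) / G ^ 2 with hℒ'
  have hℒ'w : Kato2004.PRRatio W p ℒ' :=
    (Kato2004.prRatio_iff W p ℒ').mpr ⟨hp', N', hN', f', hf', ι', q', Λ', hq', hZ', c', d₁', a', A', d'', hA',
      hc', hd', hdd', hR', z', x', hzeta', Pn.κ, Pn.isCyclotomic, Pn.γ, Pn.isTopGenerator, Pn.I, y', hy', t', P,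
      perRatio', ht', hP, hper', by rw [hℒ', hM, hG]⟩
  -- witness independence (PR-INV)
  obtain ⟨w, hw, hℒw⟩ := hPRinv W p ℒ' ℒ hℒ'w hℒ
  -- linearity of the Kummer logarithm (LOG-HOM) on K1's identity, moved to `H¹(⊤, T_pW)`
  have hkey' : c₁ • layerZeroToTop W p Pn.κ (Pn.I.proj 0 (Pn.eH D.z)) =
      c₂ • layerZeroToTop W p Pn.κ (Pn.I.proj 0 y') := by
    have h := congrArg (fun v => layerZeroToTop W p Pn.κ v) hkey
    simp only [map_smul] at h
    exact h
  have hst : (c₁ : ℚ_[p]) * s = (c₂ : ℚ_[p]) * t' := hLogHom W p _ _ c₁ c₂ s t' hkey' hs ht'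
  -- the count over (J.A, 𝐇²_Γ) at x = z₀ (COUNT), and the indices along the pin
  obtain ⟨hii, hiii⟩ := hCount W p Pn.κ Pn.γ Pn.isCyclotomic Pn.isTopGenerator Pn.I Pn.J (Pn.eH D.z) s P
    hr hp2 hadd hj htors hsha hH2 hP hs
  have hidx := zetaIndex_eq_natCard_pin Pn; have hh2 := h2Card_eq_natCard_pin Pn
  -- non-vanishing of the constants
  have hc₁Q : (c₁ : ℚ_[p]) ≠ 0 := PadicInt.coe_ne_zero.mpr hc₁; have hc₂Q : (c₂ : ℚ_[p]) ≠ 0 := PadicInt.coe_ne_zero.mpr hc₂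
  have hw0 : w ≠ 0 := fun h => by rw [h, norm_zero] at hw; exact zero_ne_one hw
  have hE : ∀ ℓ ∈ (p * A').primeFactors, eulerFactorAtOne W N' ℓ ≠ 0 := fun ℓ hℓ =>
    eulerFactorAtOne_ne_zero W hf' (Nat.prime_of_mem_primeFactors hℓ)
  have hM0 : M ≠ 0 := mul_ne_zero (mul_ne_zero hq' hR') (Finset.prod_ne_zero_iff.mpr hE)
  have hMQ : ((M : ℚ) : ℚ_[p]) ≠ 0 := by exact_mod_cast hM0
  have hlamQ : ((perRatio' : ℚ) : ℚ_[p]) ≠ 0 := by exact_mod_cast hper0'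
  have hst' : s = 0 ↔ t' = 0 := by
    constructor
    · intro h0; rw [h0, mul_zero] at hst; exact (mul_eq_zero.mp hst.symm).resolve_left hc₂Q
    · intro h0; rw [h0, mul_zero] at hst; exact (mul_eq_zero.mp hst).resolve_left hc₁Q
  have hℒ'C : ℒ' = t' * (((perRatio' : ℚ) : ℚ_[p]) / ((M : ℚ) : ℚ_[p]) / G ^ 2) := by
    rw [hℒ']; ring
  have hC0 : ((perRatio' : ℚ) : ℚ_[p]) / ((M : ℚ) : ℚ_[p]) / G ^ 2 ≠ 0 :=
    div_ne_zero (div_ne_zero hlamQ hMQ) (pow_ne_zero 2 hlogP)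
  have hℒ't : ℒ' = 0 ↔ t' = 0 := by
    rw [hℒ'C, mul_eq_zero, or_iff_left hC0]
  refine ⟨hfinH2, ?_, ?_⟩
  · -- conjunct (ii)
    rw [hidx, ← hii, hℒw, mul_ne_zero_iff]
    exact ⟨fun h hs0 => h.2 (hℒ't.mpr (hst'.mp hs0)), fun h => ⟨hw0, fun h' => h (hst'.mpr (hℒ't.mp h'))⟩⟩
  · -- conjunct (iii)
    intro m hm
    rw [hidx, hh2] at hm
    have hsv := hiii m hm
    haveI : Finite (coinvariants p Pn.J.H2) := Finite.of_equiv _ (coinvariantsEquiv Pn.eH2).toEquiv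
    have hcard : Nat.card (Pn.J.A ⧸ (IwasawaAlgebra p) ∙ Pn.J.ι (Submodule.Quotient.mk (Pn.eH D.z))) ≠ 0 := by
      rw [hm]
      exact mul_ne_zero (pow_ne_zero _ (Fact.out : p.Prime).ne_zero) Nat.card_pos.ne'
    have hs0 : s ≠ 0 := hii.mpr hcard
    have ht0 : t' ≠ 0 := fun h => hs0 (hst'.mpr h); have hℒ'0 : ℒ' ≠ 0 := fun h => ht0 (hℒ't.mp h)
    rw [hℒw, Padic.valuation_mul hw0 hℒ'0, valuation_eq_zero_of_norm_eq_one hw, zero_add]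
    have hvℒ' : ℒ'.valuation = t'.valuation + padicValRat p perRatio' - padicValRat p M - 2 * G.valuation := by
      rw [hℒ', valuation_mul_div_div_sq ht0 hlamQ hMQ hlogP, Padic.valuation_ratCast, Padic.valuation_ratCast]
    have hvs : (c₁ : ℚ_[p]).valuation + s.valuation = (c₂ : ℚ_[p]).valuation + t'.valuation := by
      have := congrArg Padic.valuation hst
      rwa [Padic.valuation_mul hc₁Q hs0, Padic.valuation_mul hc₂Q ht0] at this
    have hMeq : M = q' * ratCuspFactor f' true c' d₁' a' A' d'' *
        ∏ ℓ ∈ A'.primeFactors.erase p, eulerFactorAtOne W N' ℓ := by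
      rw [hM, prod_eulerFactorAtOne_primeFactors_mul_eq_of_addv W p hadd (hlev N' hf') hA']
    have hρ : padicValRat p (perRatio' / (q' * ratCuspFactor f' true c' d₁' a' A' d'' *
        ∏ ℓ ∈ A'.primeFactors.erase p, eulerFactorAtOne W N' ℓ)) = padicValRat p perRatio' - padicValRat p M := by
      rw [← hMeq, padicValRat.div hper0' hM0]
    rw [hρ] at hval; rw [hvℒ']; linarith

end Reduction

end Summit.BirchSwinnertonDyer.Rank1Residual.Additive.ContraCount

end
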